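import Summits.CriticalPhenomena.PercolationContinuityZ3.Theorems.PercNearOneGluingNoHeavyLowerTailStarSetResidualFacts
import Summits.CriticalPhenomena.PercolationContinuityZ3.Theorems.PercNearOneGluingNoHeavyLowerTailStarSetResidualShapes
import HarnessLib

/-!
# `NoHeavyLowerTail` (stmt-CriticalPhenomena-4575) — the residual ledger, II: the r-free word families (U1-PROOF.md §9; blueprint §G4)

Support file (prover `prim-gen-swap` gen 15; `--supports stmt-CriticalPhenomena-4575`).  No definitions, no named facts, no sorries.

The words of the residual bound whose class-sets avoid `r`: the balanced words `{X, J, dom X e}` (coefficient `1/2`) and the F-rider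
words `{X, J, ρ}` (`6/32`) are class-sets with ONE chord and a common port; the chord-rider words `{X, J, ρ}` (`6/8` of the part
`wc`) and the CROSS words `{X, Y, J}` (the part `cr`) are class-sets with TWO chords; none of them is an r-free triangle or a regular
triple (`StarSet.not_tri_of_common_port`, `not_tri_of_four_ports`, `not_rsh_of_common_port`, `not_rsh_of_uncovered_port`), so with
`wc + cr = C` they are paid by `Σ_{T ∉ TRIS ∪ REGT, T avoids r} C_T`; the far-rider words `{X, J, ρ}` (`6/128 ≤ 13/128`) are regular
triples (`StarSet.rsh_of_ports`).

* `StarSet.residual_freewords_bound`.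
-/

namespace Summit.CriticalPhenomena.PercolationContinuityZ3.Theorems

open Finset
open scoped BigOperators Classical

namespace StarSet

variable {ι V : Type*} [Fintype ι] [LinearOrder ι] [DecidableEq V]

/-- **The r-free word families of the residual bound are paid by the r-free non-triangle non-regular class-sets and `13/128` of the regular triples.**  See the file header. -/
theorem residual_freewords_bound (P P' : ι → V) (hPP' : ∀ X, P X ≠ P' X)
    (hinj : Function.Injective fun X => (s(P X, P' X) : Sym2 V)) (r : V) (F : Finset ι)
    (dom : ι → V → ι)
    (hdom : ∀ X ∉ F, ∀ d, (P X = d ∨ P' X = d) →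
      dom X d ∈ F ∧ (P (dom X d) = d ∨ P' (dom X d) = d) ∧
        (∀ u, (P (dom X d) = u ∨ P' (dom X d) = u) → (P X = u ∨ P' X = u) → u = d))
    (I₀ : ι) (hleaf : ∀ I ∈ F, P' I = r → I = I₀) (hI₀r : I₀ ∈ F → P' I₀ = r)
    (U : Finset (Finset ι × ι)) (Jf : Finset ι × ι → ι) (ef ēf : Finset ι × ι → V) (ρf : Finset ι × ι → ι)
    (hdata : (∀ u ∈ U, u.2 ∈ u.1 ∧ u.2 ∉ F ∧ (P u.2 ≠ r ∧ P' u.2 ≠ r) ∧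
      (∀ Y ∈ u.1, P Y = P u.2 ∨ P Y = P' u.2 ∨ P' Y = P u.2 ∨ P' Y = P' u.2) ∧
      ¬ ((∀ I ∈ F, I ∉ u.1) ∨ ∃ a ∈ F, P a = r ∧ a ∈ u.1 ∧ ∀ b ∈ F, b < a → b ∉ u.1) ∧
      Jf u ∈ u.1 ∧ Jf u ∈ F ∧ (∀ I ∈ u.1, I ∈ F → Jf u ≤ I) ∧ P (Jf u) ≠ r ∧
      ((P u.2 = ef u ∧ P' u.2 = ēf u) ∨ (P u.2 = ēf u ∧ P' u.2 = ef u)) ∧ (P (Jf u) = ef u ∨ P' (Jf u) = ef u) ∧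
      ¬ (P (Jf u) = ēf u ∨ P' (Jf u) = ēf u) ∧
      ((P (Jf u) = ef u ∧ P' (Jf u) = r ∧ P (dom u.2 (ēf u)) ≠ r ∧ P' (dom u.2 (ēf u)) ≠ r) ∨
       (P (Jf u) ≠ r ∧ P' (Jf u) ≠ r ∧
        ((P (dom u.2 (ēf u)) = r ∧ P' (dom u.2 (ēf u)) = ēf u ∧ Jf u < dom u.2 (ēf u)) ∨
         (P (dom u.2 (ēf u)) = ēf u ∧ P' (dom u.2 (ēf u)) = r)))) ∧
      (∀ Y ∈ u.1, Y ≠ u.2 → (P Y ≠ r ∧ P' Y ≠ r) → ∀ p, (P u.2 = p ∨ P' u.2 = p) → (P Y ≠ p ∧ P' Y ≠ p) →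
        (P (dom u.2 p) = r ∨ P' (dom u.2 p) = r))))
    (hρ : (∀ u ∈ U, (((u.1.erase u.2).erase (Jf u)).filter (fun K => (P K ≠ r ∧ P' K ≠ r) ∧ K ≠ dom u.2 (ēf u))).Nonempty → ρf u ∈
        (((u.1.erase u.2).erase (Jf u)).filter (fun K => (P K ≠ r ∧ P' K ≠ r) ∧ K ≠ dom u.2 (ēf u)))))
    (UBAL URF URC URFAR UG : Finset (Finset ι × ι))
    (hUBAL : UBAL = U.filter (fun u => (¬ (P (Jf u) = ef u ∧ P' (Jf u) = r) ∧ dom u.2 (ef u) ≠ Jf u ∧ (P (dom u.2 (ef u)) ≠ r ∧ P' (dom u.2 (ef u)) ≠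
        r))))
    (hURF : URF = U.filter (fun u => ¬ (P (Jf u) = ef u ∧ P' (Jf u) = r) ∧ ¬ (¬ (P (Jf u) = ef u ∧ P' (Jf u) = r) ∧ dom u.2 (ef u) ≠ Jf u ∧ (P (dom
        u.2 (ef u)) ≠ r ∧ P' (dom u.2 (ef u)) ≠ r)) ∧ (((u.1.erase u.2).erase (Jf u)).filter (fun K => (P K ≠ r ∧ P' K ≠ r) ∧ K ≠
        dom u.2 (ēf u))).Nonempty ∧ (P (ρf u) = ef u ∨ P' (ρf u) = ef u) ∧ ρf u ∈ F))
    (hURC : URC = U.filter (fun u => ¬ (P (Jf u) = ef u ∧ P' (Jf u) = r) ∧ ¬ (¬ (P (Jf u) = ef u ∧ P' (Jf u) = r) ∧ dom u.2 (ef u) ≠ Jf u ∧ (P (dom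
        u.2 (ef u)) ≠ r ∧ P' (dom u.2 (ef u)) ≠ r)) ∧ (((u.1.erase u.2).erase (Jf u)).filter (fun K => (P K ≠ r ∧ P' K ≠ r) ∧ K ≠
        dom u.2 (ēf u))).Nonempty ∧ (P (ρf u) = ef u ∨ P' (ρf u) = ef u) ∧ ρf u ∉ F))
    (hURFAR : URFAR = U.filter (fun u => ¬ (P (Jf u) = ef u ∧ P' (Jf u) = r) ∧ ¬ (¬ (P (Jf u) = ef u ∧ P' (Jf u) = r) ∧ dom u.2 (ef u) ≠ Jf u ∧ (P (dom
        u.2 (ef u)) ≠ r ∧ P' (dom u.2 (ef u)) ≠ r)) ∧ (((u.1.erase u.2).erase (Jf u)).filter (fun K => (P K ≠ r ∧ P' K ≠ r) ∧ K ≠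
        dom u.2 (ēf u))).Nonempty ∧ ¬ (P (ρf u) = ef u ∨ P' (ρf u) = ef u)))
    (hUG : UG = U.filter (fun u => ¬ (P (Jf u) = ef u ∧ P' (Jf u) = r) ∧ ¬ (¬ (P (Jf u) = ef u ∧ P' (Jf u) = r) ∧ dom u.2 (ef u) ≠ Jf u ∧ (P (dom
        u.2 (ef u)) ≠ r ∧ P' (dom u.2 (ef u)) ≠ r)) ∧ ¬ (((u.1.erase u.2).erase (Jf u)).filter (fun K => (P K ≠ r ∧ P' K ≠ r) ∧ K
        ≠ dom u.2 (ēf u))).Nonempty ∧ ¬ (P' (dom u.2 (ēf u)) = r ∧ Jf u = dom u.2 (ef u))))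
    (TRIS REGT : Finset (Finset ι))
    (hTRIS : ∀ T, T ∈ TRIS ↔ ∃ (a b c : V) (X Y Z : ι), a ≠ b ∧ a ≠ c ∧ b ≠ c ∧ a ≠ r ∧ b ≠ r ∧ c ≠ r ∧
        (s(P X, P' X) : Sym2 V) = s(a, b) ∧ (s(P Y, P' Y) : Sym2 V) = s(a, c) ∧ (s(P Z, P' Z) : Sym2 V) = s(b, c) ∧
        T = {X, Y, Z})
    (hREGT : ∀ T, T ∈ REGT ↔ ∃ (M E₁ E₂ : ι) (q₁ q₂ f₁ f₂ : V),
          M ∉ F ∧ (s(P M, P' M) : Sym2 V) = s(q₁, q₂) ∧ (s(P E₁, P' E₁) : Sym2 V) = s(q₁, f₁) ∧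
          (s(P E₂, P' E₂) : Sym2 V) = s(q₂, f₂) ∧ q₁ ≠ q₂ ∧ f₁ ≠ q₁ ∧ f₁ ≠ q₂ ∧ f₂ ≠ q₁ ∧ f₂ ≠ q₂ ∧
          q₁ ≠ r ∧ q₂ ≠ r ∧ f₁ ≠ r ∧ f₂ ≠ r ∧ T = {M, E₁, E₂})
    (C wc cr : Finset ι → ℝ) (hC0 : ∀ T, 0 ≤ C T) (hwc0 : ∀ T, 0 ≤ wc T) (hcr0 : ∀ T, 0 ≤ cr T)
    (hwccr : ∀ T, wc T + cr T = C T) :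
    (1 / 2) * ∑ T ∈ (UBAL.image (fun u => ({u.2, Jf u, dom u.2 (ef u)} : Finset ι))), C T +
      (6 / 32) * ∑ T ∈ (URF.image (fun u => ({u.2, Jf u, ρf u} : Finset ι))), C T +
      (6 / 8) * ∑ T ∈ (URC.image (fun u => ({u.2, Jf u, ρf u} : Finset ι))), wc T +
      ∑ T ∈ (((UG ×ˢ UG).filter (fun w => Jf w.1 = Jf w.2 ∧ w.1.2 < w.2.2 ∧ ēf w.1 ≠ ēf w.2)).image
          (fun w => ({w.1.2, w.2.2, Jf w.1} : Finset ι))), cr T +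
      (6 / 128) * ∑ T ∈ (URFAR.image (fun u => ({u.2, Jf u, ρf u} : Finset ι))), C T ≤
      ∑ T ∈ ((univ : Finset ι).powerset.filter (fun T => T ∉ TRIS ∧ T ∉ REGT)).filter
          (fun T => ¬ ∃ K ∈ T, P K = r ∨ P' K = r), C T +
      (13 / 128) * ∑ T ∈ REGT, C T := by
  have facts := residual_unit_facts P P' hPP' hinj r F dom hdom I₀ hleaf hI₀r U Jf ef ēf ρf hdata hρ
  -- ports of a hub
  have hports : ∀ u ∈ U, ∀ x, (P u.2 = x ∨ P' u.2 = x) → x = ef u ∨ x = ēf u := by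
    intro u hu x hx
    obtain ⟨-, -, -, -, -, -, -, -, -, hX, -⟩ := hdata u hu
    rcases hX with ⟨h1, h2⟩ | ⟨h1, h2⟩ <;> rcases hx with h | h
    · exact Or.inl (h.symm.trans h1)
    · exact Or.inr (h.symm.trans h2)
    · exact Or.inr (h.symm.trans h1)
    · exact Or.inl (h.symm.trans h2)
  -- an adjacent class passes through `e` or through `ē`
  have hadjport : ∀ u ∈ U, ∀ K, (P K = P u.2 ∨ P K = P' u.2 ∨ P' K = P u.2 ∨ P' K = P' u.2) →
      (P K = ef u ∨ P' K = ef u) ∨ (P K = ēf u ∨ P' K = ēf u) := by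
    intro u hu K hK
    obtain ⟨-, -, -, -, -, -, -, -, -, hX, -⟩ := hdata u hu
    rcases hX with ⟨hx1, hx2⟩ | ⟨hx1, hx2⟩ <;> rw [hx1, hx2] at hK
    · rcases hK with h | h | h | h
      exacts [Or.inl (Or.inl h), Or.inr (Or.inl h), Or.inl (Or.inr h), Or.inr (Or.inr h)]
    · rcases hK with h | h | h | h
      exacts [Or.inr (Or.inl h), Or.inl (Or.inl h), Or.inr (Or.inr h), Or.inl (Or.inr h)]
  set NTF := ((univ : Finset ι).powerset.filter (fun T => T ∉ TRIS ∧ T ∉ REGT)).filter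
      (fun T => ¬ ∃ K ∈ T, P K = r ∨ P' K = r) with hNTF
  set S1 := NTF.filter (fun T => (T.filter (fun K => K ∉ F)).card = 1) with hS1
  set S2 := NTF.filter (fun T => (T.filter (fun K => K ∉ F)).card = 2) with hS2
  -- membership test
  have hmemS : ∀ (T : Finset ι) (n : ℕ),
      (¬ ∃ (a b c : V) (X Y Z : ι), a ≠ b ∧ a ≠ c ∧ b ≠ c ∧ a ≠ r ∧ b ≠ r ∧ c ≠ r ∧
        (s(P X, P' X) : Sym2 V) = s(a, b) ∧ (s(P Y, P' Y) : Sym2 V) = s(a, c) ∧ (s(P Z, P' Z) : Sym2 V) = s(b, c) ∧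
        T = {X, Y, Z}) →
      (¬ ∃ (M E₁ E₂ : ι) (q₁ q₂ f₁ f₂ : V),
          M ∉ F ∧ (s(P M, P' M) : Sym2 V) = s(q₁, q₂) ∧ (s(P E₁, P' E₁) : Sym2 V) = s(q₁, f₁) ∧
          (s(P E₂, P' E₂) : Sym2 V) = s(q₂, f₂) ∧ q₁ ≠ q₂ ∧ f₁ ≠ q₁ ∧ f₁ ≠ q₂ ∧ f₂ ≠ q₁ ∧ f₂ ≠ q₂ ∧
          q₁ ≠ r ∧ q₂ ≠ r ∧ f₁ ≠ r ∧ f₂ ≠ r ∧ T = {M, E₁, E₂}) →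
      (∀ K ∈ T, P K ≠ r ∧ P' K ≠ r) → (T.filter (fun K => K ∉ F)).card = n →
      T ∈ NTF.filter (fun T => (T.filter (fun K => K ∉ F)).card = n) := by
    intro T n htri hrsh hfree hcard
    refine mem_filter.2 ⟨mem_filter.2 ⟨mem_filter.2 ⟨mem_powerset.2 (subset_univ _), fun h => htri ((hTRIS T).1 h),
      fun h => hrsh ((hREGT T).1 h)⟩, ?_⟩, hcard⟩
    rintro ⟨K, hK, hKr⟩
    rcases hKr with h | h; exacts [(hfree K hK).1 h, (hfree K hK).2 h]
  have hmem3 : ∀ (a b c x : ι), x ∈ ({a, b, c} : Finset ι) ↔ x = a ∨ x = b ∨ x = c := by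
    intro a b c x; simp only [mem_insert, mem_singleton]
  -- (a) balanced words: one chord, common port `e`
  have hBAL : ∀ T ∈ UBAL.image (fun u => ({u.2, Jf u, dom u.2 (ef u)} : Finset ι)), T ∈ S1 := by
    intro T hT
    obtain ⟨u, hu, rfl⟩ := mem_image.1 hT
    rw [hUBAL, mem_filter] at hu
    obtain ⟨huU, hn1, -, hDcold⟩ := hu
    obtain ⟨-, hXF, hXr, -, -, -, hJF, -, -, -, hJe, -, -, -⟩ := hdata u huU
    obtain ⟨heX, -, -, -, -, -, -, ⟨hDeF, hDee⟩, hoff, -⟩ := facts u huU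
    obtain ⟨hJr, -, -⟩ := hoff hn1
    have hcp : ∀ K ∈ ({u.2, Jf u, dom u.2 (ef u)} : Finset ι), P K = ef u ∨ P' K = ef u := by
      intro K hK; rw [hmem3] at hK
      rcases hK with rfl | rfl | rfl; exacts [heX, hJe, hDee]
    refine hmemS _ 1 (not_tri_of_common_port P P' r _ (ef u) hcp) (not_rsh_of_common_port P P' r F _ (ef u) hcp) ?_ ?_
    · intro K hK; rw [hmem3] at hK
      rcases hK with rfl | rfl | rfl; exacts [hXr, hJr, hDcold]
    · simp [filter_insert, filter_singleton, hXF, hJF, hDeF]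
  -- (b), (c) riders through `e`
  have hRID : ∀ u ∈ U, ¬ (P (Jf u) = ef u ∧ P' (Jf u) = r) →
      (((u.1.erase u.2).erase (Jf u)).filter (fun K => (P K ≠ r ∧ P' K ≠ r) ∧ K ≠ dom u.2 (ēf u))).Nonempty →
      (P (ρf u) = ef u ∨ P' (ρf u) = ef u) →
      (∀ K ∈ ({u.2, Jf u, ρf u} : Finset ι), P K = ef u ∨ P' K = ef u) ∧
      (∀ K ∈ ({u.2, Jf u, ρf u} : Finset ι), P K ≠ r ∧ P' K ≠ r) ∧ u.2 ∉ F ∧ Jf u ∈ F ∧ ρf u ≠ u.2 := by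
    intro u huU hn1 hne hρe
    obtain ⟨-, hXF, hXr, -, -, -, hJF, -, -, -, hJe, -, -, -⟩ := hdata u huU
    obtain ⟨heX, -, -, -, -, -, -, -, hoff, -, hrid, -, -⟩ := facts u huU
    obtain ⟨hJr, -, -⟩ := hoff hn1
    obtain ⟨-, hρX, -, hρr, -, -, -⟩ := hrid hne
    refine ⟨fun K hK => ?_, fun K hK => ?_, hXF, hJF, hρX⟩
    · rw [hmem3] at hK; rcases hK with rfl | rfl | rfl; exacts [heX, hJe, hρe]
    · rw [hmem3] at hK; rcases hK with rfl | rfl | rfl; exacts [hXr, hJr, hρr]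
  have hRF : ∀ T ∈ URF.image (fun u => ({u.2, Jf u, ρf u} : Finset ι)), T ∈ S1 := by
    intro T hT
    obtain ⟨u, hu, rfl⟩ := mem_image.1 hT
    rw [hURF, mem_filter] at hu
    obtain ⟨huU, hn1, -, hne, hρe, hρF⟩ := hu
    obtain ⟨hcp, hfree, hXF, hJF, -⟩ := hRID u huU hn1 hne hρe
    refine hmemS _ 1 (not_tri_of_common_port P P' r _ (ef u) hcp) (not_rsh_of_common_port P P' r F _ (ef u) hcp) hfree ?_
    simp [filter_insert, filter_singleton, hXF, hJF, hρF]
  have hRC : ∀ T ∈ URC.image (fun u => ({u.2, Jf u, ρf u} : Finset ι)), T ∈ S2 := by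
    intro T hT
    obtain ⟨u, hu, rfl⟩ := mem_image.1 hT
    rw [hURC, mem_filter] at hu
    obtain ⟨huU, hn1, -, hne, hρe, hρF⟩ := hu
    obtain ⟨hcp, hfree, hXF, hJF, hρX⟩ := hRID u huU hn1 hne hρe
    refine hmemS _ 2 (not_tri_of_common_port P P' r _ (ef u) hcp) (not_rsh_of_common_port P P' r F _ (ef u) hcp) hfree ?_
    simp [filter_insert, filter_singleton, hXF, hJF, hρF, card_pair hρX.symm]
  -- (d) CROSS words: two chords; four ports or a common port; the chords have uncovered ports
  have hCR : ∀ T ∈ ((UG ×ˢ UG).filter (fun w => Jf w.1 = Jf w.2 ∧ w.1.2 < w.2.2 ∧ ēf w.1 ≠ ēf w.2)).image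
      (fun w => ({w.1.2, w.2.2, Jf w.1} : Finset ι)), T ∈ S2 := by
    intro T hT
    obtain ⟨w, hw, rfl⟩ := mem_image.1 hT
    obtain ⟨hw, hJJ, hlt, hēē⟩ := mem_filter.1 hw
    obtain ⟨hw1, hw2⟩ := mem_product.1 hw
    rw [hUG, mem_filter] at hw1 hw2
    obtain ⟨hU1, hn1, -⟩ := hw1
    obtain ⟨hU2, hn2, -⟩ := hw2
    obtain ⟨-, hXF1, hXr1, -, -, -, hJF, -, -, -, hJe1, hJē1, -, -⟩ := hdata w.1 hU1
    obtain ⟨-, hXF2, hXr2, -, -, -, -, -, -, -, hJe2, hJē2, -, -⟩ := hdata w.2 hU2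
    obtain ⟨heX1, hēX1, heē1, -, -, -, -, -, hoff1, -⟩ := facts w.1 hU1
    obtain ⟨heX2, hēX2, heē2, -⟩ := facts w.2 hU2
    obtain ⟨hJr, -, -⟩ := hoff1 hn1
    rw [← hJJ] at hJe2 hJē2
    have hXY : w.1.2 ≠ w.2.2 := ne_of_lt hlt
    -- the far ports are not in `J`, hence differ from the near ports
    have h14 : ef w.1 ≠ ēf w.2 := fun h => hJē2 (h ▸ hJe1)
    have h23 : ef w.2 ≠ ēf w.1 := fun h => hJē1 (h ▸ hJe2)
    have hfree : ∀ K ∈ ({w.1.2, w.2.2, Jf w.1} : Finset ι), P K ≠ r ∧ P' K ≠ r := by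
      intro K hK; rw [hmem3] at hK; rcases hK with rfl | rfl | rfl; exacts [hXr1, hXr2, hJr]
    have htri : ¬ ∃ (a b c : V) (X Y Z : ι), a ≠ b ∧ a ≠ c ∧ b ≠ c ∧ a ≠ r ∧ b ≠ r ∧ c ≠ r ∧
        (s(P X, P' X) : Sym2 V) = s(a, b) ∧ (s(P Y, P' Y) : Sym2 V) = s(a, c) ∧ (s(P Z, P' Z) : Sym2 V) = s(b, c) ∧
        ({w.1.2, w.2.2, Jf w.1} : Finset ι) = {X, Y, Z} := by
      by_cases he : ef w.1 = ef w.2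
      · refine not_tri_of_common_port P P' r _ (ef w.1) fun K hK => ?_
        rw [hmem3] at hK; rcases hK with rfl | rfl | rfl; exacts [heX1, he ▸ heX2, hJe1]
      · exact not_tri_of_four_ports P P' r _ (ef w.1) (ef w.2) (ēf w.1) (ēf w.2) he heē1 h14 h23 heē2 hēē
          ⟨w.1.2, by simp, heX1⟩ ⟨w.2.2, by simp, heX2⟩ ⟨w.1.2, by simp, hēX1⟩ ⟨w.2.2, by simp, hēX2⟩
    have hrsh := not_rsh_of_uncovered_port P P' r F ({w.1.2, w.2.2, Jf w.1} : Finset ι) (fun M hM hMF => by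
      rw [hmem3] at hM
      rcases hM with rfl | rfl | rfl
      · refine ⟨ēf w.1, hēX1, fun K hK hKM => ?_⟩
        rw [hmem3] at hK
        rcases hK with rfl | rfl | rfl
        · exact absurd rfl hKM
        · intro h
          rcases hports w.2 hU2 _ h with h' | h'
          · exact h23 h'.symm
          · exact hēē h'
        · exact hJē1
      · refine ⟨ēf w.2, hēX2, fun K hK hKM => ?_⟩
        rw [hmem3] at hK
        rcases hK with rfl | rfl | rfl
        · intro h
          rcases hports w.1 hU1 _ h with h' | h'
          · exact h14 h'.symm
          · exact hēē h'.symm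
        · exact absurd rfl hKM
        · exact hJē2
      · exact absurd hJF hMF)
    refine hmemS _ 2 htri hrsh hfree ?_
    simp [filter_insert, filter_singleton, hXF1, hXF2, hJF, card_pair hXY]
  -- (e) far riders: regular triples
  have hRFar : ∀ T ∈ URFAR.image (fun u => ({u.2, Jf u, ρf u} : Finset ι)), T ∈ REGT := by
    intro T hT
    obtain ⟨u, hu, rfl⟩ := mem_image.1 hT
    rw [hURFAR, mem_filter] at hu
    obtain ⟨huU, hn1, -, hne, hρe⟩ := hu
    obtain ⟨-, hXF, -, -, -, -, -, -, -, hX, hJe, hJē, -, -⟩ := hdata u huU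
    obtain ⟨-, -, heē, her, hēr, -, -, -, hoff, -, hrid, -, -⟩ := facts u huU
    obtain ⟨hJr, -, -⟩ := hoff hn1
    obtain ⟨-, -, -, hρr, -, hρadj, -⟩ := hrid hne
    have hρē : P (ρf u) = ēf u ∨ P' (ρf u) = ēf u := (hadjport u huU _ hρadj).resolve_left hρe
    exact (hREGT _).2 (rsh_of_ports P P' hPP' r F hXF hX heē her hēr hJe hJē hJr hρē hρe hρr)
  -- the sums
  have h1 := sum_le_sum_of_subset_of_nonneg (f := C) (fun T hT => hBAL T hT) (fun T _ _ => hC0 T)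
  have h2 := sum_le_sum_of_subset_of_nonneg (f := C) (fun T hT => hRF T hT) (fun T _ _ => hC0 T)
  have h3 := sum_le_sum_of_subset_of_nonneg (f := wc) (fun T hT => hRC T hT) (fun T _ _ => hwc0 T)
  have h4 := sum_le_sum_of_subset_of_nonneg (f := cr) (fun T hT => hCR T hT) (fun T _ _ => hcr0 T)
  have h5 := sum_le_sum_of_subset_of_nonneg (f := C) (fun T hT => hRFar T hT) (fun T _ _ => hC0 T)
  have h6 : ∑ T ∈ S2, wc T + ∑ T ∈ S2, cr T = ∑ T ∈ S2, C T := by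
    rw [← sum_add_distrib]; exact sum_congr rfl fun T _ => hwccr T
  have h7 : ∑ T ∈ S1, C T + ∑ T ∈ S2, C T ≤ ∑ T ∈ NTF, C T := by
    rw [← sum_union (disjoint_filter.2 fun T _ h1 h2 => by rw [h1] at h2; exact absurd h2 (by norm_num))]
    exact sum_le_sum_of_subset_of_nonneg (union_subset (filter_subset _ _) (filter_subset _ _)) fun T _ _ => hC0 T
  have hS1n : 0 ≤ ∑ T ∈ S1, C T := sum_nonneg fun T _ => hC0 T
  have hS2n : 0 ≤ ∑ T ∈ S2, wc T := sum_nonneg fun T _ => hwc0 T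
  have hRn : 0 ≤ ∑ T ∈ REGT, C T := sum_nonneg fun T _ => hC0 T
  linarith

end StarSet

end Summit.CriticalPhenomena.PercolationContinuityZ3.Theorems
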